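import Summits.QuantumFields.QCD.Theses.SpectralDefectExtinction
import Summits.QuantumFields.QCD.Theorems.SpectralDefectExtinctionPositivityDeficitLeDefects
import Literature.MathematicalPhysics.QuantumFieldTheory.QCDPhaseQuenched
import Literature.MathematicalPhysics.QuantumLattice.WilsonDiracAP

/-!
# Stub `stub_honestPartitionPos` of line `block-away-the-sign`
(crux `Summit.QuantumFields.QCD.Theses.SpectralDefectExtinction.ExtinctionBuildsQCD`, item stmt-QuantumFields-18064)

FIRST LEMMA of the line: the honest (periodic) Wilson partition function is positive at the scheme's own
torus side `S = L_k`, eventually in `k`.  If the sign half of EXTINCT holds at `S = L_k` — the phase-quenched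
expected number of real eigenvalues of `D_W(U,0,1)` below every `−m_f(k)` is eventually `≤ ε` for every
`ε > 0` — then `0 < ∫ Re ∏_f det D_W(U, m_f(k), 1) dμ_W` eventually in `k`.

Proof.  The proved support `PositivityDeficitLeDefects`
(`Summit.QuantumFields.QCD.Theorems.PositivityDeficitLeDefects.positivityDeficitLeDefects_proof`) reads, torus
by torus, `(1 − N/Z)/2 ≤ E₊[# sign defects]` with `N = ∫ Re ∏_f det D_W(m_f)` and `Z = ∫ ∏_f |det D_W(m_f)| ≥ 0`.
Take the hypothesis at `ε = 1/4`: then `(1 − N/Z)/2 ≤ 1/4`, i.e. `N/Z ≥ 1/2 > 0`.  A vanishing `Z` is excluded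
because the Lean quotient `N/0 = 0` would read `1/2 ≤ 0`; hence `Z > 0` and `N > 0`.  Pure real arithmetic after
instantiating the support at `L := 2 L_k + 1`, `β := β_k`, `m_f := m_crit(k) + a_k m_f / Z_m(k)`.
-/

noncomputable section

namespace Summit.QuantumFields.QCD.Cruxes.ExtinctionBuildsQCD.BlockAwayTheSign

open scoped BigOperators Topology Classical MeasureTheory Matrix
open Filter MeasureTheory Matrix
open Literature.MathematicalPhysics.QuantumLattice Literature.MathematicalPhysics.AQFT
  Literature.MathematicalPhysics.QuantumFieldTheory
open Summit.QuantumFields.QCD.Theses.SpectralDefectExtinction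
open Summit.QuantumFields.QCD.Theses
open Summit.QuantumFields.QCD.Theorems.PositivityDeficitLeDefects (positivityDeficitLeDefects_proof)

/-- **The real-arithmetic core.** If `Z ≥ 0`, the positivity deficit `(1 − N/Z)/2` is at most `D`, and
`D ≤ ε < 1/2`, then `N > 0`: indeed `N/Z > 0`, which excludes `Z = 0` (Lean's `N/0 = 0`), so `Z > 0` and
`N > 0`. -/
theorem honestPartitionPos_of_deficit_le {N Z D ε : ℝ} (hZ : 0 ≤ Z) (hP : (1 - N / Z) / 2 ≤ D)
    (hD : D ≤ ε) (hε : ε < 1 / 2) : 0 < N := by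
  have hNZ : 0 < N / Z := by linarith
  rcases hZ.eq_or_lt with hZ0 | hZpos
  · rw [← hZ0, div_zero] at hNZ
    exact absurd hNZ (lt_irrefl 0)
  · exact (div_pos_iff_of_pos_right hZpos).mp hNZ

/-- **Stub P — FIRST LEMMA of the line: the honest (periodic) partition function is positive at the scheme's own
side (provable now).** If the sign half of EXTINCT holds at `S = L_k` for the tuple `m`, then
`∫ Re ∏_f det D_W(U, m_f(k), 1) dμ_W > 0` eventually in `k` — the non-junk denominator of `qcdLatticeSchwinger` and the
`0 < ∫ w` clause at the scheme volume. Route: the proved support `PositivityDeficitLeDefects`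
(`Theorems/SpectralDefectExtinctionPositivityDeficitLeDefects.lean`, `positivityDeficitLeDefects_proof`) reads
`(1 − ⟨sign⟩₊)/2 ≤ E₊[# sign defects]`; with `ε = 1/4` this gives `⟨sign⟩₊ ≥ 1/2`, and a vanishing or negative
numerator is excluded (a zero denominator would make the Lean ratio `0`, i.e. `1/2 ≤ 1/4`).
[EdwardsHellerNarayanan1998; MohlerSchaefer2020 §2; MontvayMunster1994 §4.1] -/
theorem stub_honestPartitionPos :
    ∀ {Nf : ℕ} (reg : QCDRegularisation Nf) (m : Fin Nf → ℝ),
      (∀ ε : ℝ, 0 < ε → ∀ᶠ k : ℕ in Filter.atTop,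
        (∫ (U : GaugeConfig 4 (2 * reg.L k + 1) SU3), (∑ f : Fin Nf, (Multiset.countP (fun z : ℂ => z.im = 0 ∧ z.re < -(reg.mcrit k + reg.a k * m f / reg.Zm k)) (wilsonDirac (fundamentalRep (Fin 3)) U 0 1).charpoly.roots : ℝ)) * ∏ f : Fin Nf, ‖fermionDet (wilsonDirac (fundamentalRep (Fin 3)) U (reg.mcrit k + reg.a k * m f / reg.Zm k) 1)‖ ∂(wilsonMeasure (fundamentalRep (Fin 3)) (reg.β k))) / (∫ (U : GaugeConfig 4 (2 * reg.L k + 1) SU3), ∏ f : Fin Nf, ‖fermionDet (wilsonDirac (fundamentalRep (Fin 3)) U (reg.mcrit k + reg.a k * m f / reg.Zm k) 1)‖ ∂(wilsonMeasure (fundamentalRep (Fin 3)) (reg.β k))) ≤ ε) →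
      ∀ᶠ k : ℕ in Filter.atTop,
        0 < ∫ (U : GaugeConfig 4 (2 * reg.L k + 1) SU3), (∏ f : Fin Nf, fermionDet (wilsonDirac (fundamentalRep (Fin 3)) U (reg.mcrit k + reg.a k * m f / reg.Zm k) 1)).re ∂(wilsonMeasure (fundamentalRep (Fin 3)) (reg.β k)) := by
  intro Nf reg m h
  filter_upwards [h (1 / 4) (by norm_num)] with k hk
  have hP := positivityDeficitLeDefects_proof Nf (2 * reg.L k + 1) (reg.β k)
    (fun f => reg.mcrit k + reg.a k * m f / reg.Zm k)
  have hZ : 0 ≤ ∫ (U : GaugeConfig 4 (2 * reg.L k + 1) SU3), ∏ f : Fin Nf,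
      ‖fermionDet (wilsonDirac (fundamentalRep (Fin 3)) U (reg.mcrit k + reg.a k * m f / reg.Zm k) 1)‖
        ∂(wilsonMeasure (fundamentalRep (Fin 3)) (reg.β k)) :=
    integral_nonneg fun U => Finset.prod_nonneg fun f _ => norm_nonneg _
  exact honestPartitionPos_of_deficit_le hZ hP hk (by norm_num)

end Summit.QuantumFields.QCD.Cruxes.ExtinctionBuildsQCD.BlockAwayTheSign

end
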